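import Literature.Analysis.Calculus.IteratedFDerivBlockPeelingTwoStage        -- ★ (this seat) (E5): `contDiffOn_and_forall_bound_twoStage_nestedBlockReaders`; brings ★ (E4) p851329
import Literature.NumberTheory.Automorphic.ArchCentralTowerFubini                -- ★ p851321 (this seat): `centralTower_zero ∕ _eq_zero ∕ _succ`; brings ★ p851275 central reader sockets
import Literature.NumberTheory.Automorphic.ArchCayleyTowerFubini                 -- ★ p851247 (LH7-p02 (g4)) (J): face tower `towerH_zero ∕ _eq_zero ∕ _succ`
import Literature.NumberTheory.Automorphic.ArchRankOneCornerSocketsCayley        -- ★ (F0P3a-p04 (g24)) (X3-rk1): `cayley_nestedReader_hunif ∕ _hread` (face reader sockets)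
import HarnessLib

/-!
# THE MIXED TOWER: joint smoothness off the walls and UNIFORM JET BOUNDS for the two-stage orbital tower «faces (rank-one `U(J)` blocks) inside, scalar compact places (rank-two
# `G_w` blocks) outside» of a jointly smooth, compactly supported block family (Harish-Chandra ∕ Warner II Thm. 8.4.3.1 at the scalar places, Varadarajan 1977 I §1.12 at the faces,
# Bouaziz 1994 §3.1 (I₁); the analytic core of organ O-L1d′)

Topic `NumberTheory/Rogawski1990`; namespace `Literature.NumberTheory.Rogawski1990`.  THEOREMS ONLY (no `def`, no instance, no notation, no axiom, no named fact, no `sorry`); kernel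
lane `--kind proof --supports stmt-HodgeConjecture-24833`.  Cell `pub/hodgecm-mathlib`, crux H413 (`stmt-HodgeConjecture-24833`), F0∕P3c line LH3 (leaf `F0_P3c_StubN9Direct` v5.1), organ
**O-L1d′ `stub_N9hcCentralMixedJetBounds`** (LH3-plan (g4) RULING #19: (hCm-ASM) → F0P3a-p08 (g23)); brick «MIXED TOWER BOUNDS» = ★ (E5) INSTANTIATED with every socket discharged:
stage 1 (faces) — block type `(M₂(ℂ), ℝ)`, ONE reader (index `Unit`) = the centre-`1` `U(J)`-Cayley functional `F f ψ = (2 sin ψ) • ∫_{U(J)} f(↑↑(h·P diag(e^{iψ},e^{−iψ})P⁻¹·h⁻¹)) dμ₀`,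
`T₁ = {sin ψ ≠ 0}`, `T₀₁ = [−½, ½]`, sockets ★ `cayley_nestedReader_hunif ∕ _hread` (F0P3a-p04), tower ★ `towerH_*` (LH7-p02); stage 2 (scalar compact places) — block type
`(M₃(ℂ), Fin 3 → ℝ)`, readers indexed by PLACES `Φ_w F θ = (rootProduct θ) • ∫_{G_w} F(↑↑(g·diag(ζ_w e^{iθ})·g⁻¹)) dν_w`, `T₂` = chambers ∩ `B(0,½)`, `T₀₂ = B(0,¼)`, sockets ★ p851275,
tower ★ `centralTower_*` (p851321) along the slot map `e₂ : ℕ → places`.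
HEAD **`contDiffOn_and_forall_bound_mixedTower`**: for a base family `f : P × ((Fin m₁ → M₂(ℂ)) × (Fin m₂ → M₃(ℂ))) → E` smooth on `Q ×ˢ univ` (`Q ⊆ P` open), vanishing as soon as one block
variable leaves a compact, with joint jets bounded on `(S ∩ Q) ×ˢ univ`, the MIXED TOWER FUNCTION `((q, ψ), θ) ↦ H₂ e₂ m₂ (H₁ m₁ f)` is `C^∞` on `(Q ×ˢ T₁^{m₁}) ×ˢ T₂^{m₂}` and every jet
`‖Dⁿ‖` is bounded on `((S ∩ Q) ×ˢ (T₁ ∩ T₀₁)^{m₁}) ×ˢ (T₂ ∩ T₀₂)^{m₂}`.  With the chart junction ★ `exists_nhds_bddAbove_norm_iteratedFDeriv_of_chartModel` this leaves, for `hCm`, only the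
MODEL identity (finset isolation in the unfolded currency + per-face descent + cofactor dress).
HONEST LABEL: count-neutral; HC_CM is proved only modulo the 7 printed citations (2 remaining: hLiu418 = stmt-HodgeConjecture-24832, h413 = stmt-HodgeConjecture-24833) until rung 0 closes.

## References
* [WarnerHASSLG2] G. Warner, *Harmonic Analysis on Semi-Simple Lie Groups II*, Springer (1972), Thm. 8.4.3.1.
* [Varadarajan1977] V. S. Varadarajan, *Harmonic Analysis on Real Reductive Groups*, LNM 576 (1977), Part I §1.12, §3.
* [Bouaziz1994IntegralesOrbitales] A. Bouaziz, *Intégrales orbitales sur les groupes de Lie réductifs*, Ann. Sci. ÉNS 27 (1994), §3.1 (I₁)–(I₂) p. 579.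
* [HormanderALPDO1] L. Hörmander, *The Analysis of Linear Partial Differential Operators I*, 2nd ed. (1990), §1.1 Thm. 1.1.8–1.1.9.
-/

set_option autoImplicit false

noncomputable section

open MeasureTheory MeasureTheory.Measure Set Filter Topology Function Metric NumberField NumberField.InfinitePlace
open Literature.NumberTheory.Automorphic Literature.NumberTheory.Automorphic.UnitaryGroup Literature.Analysis.Calculus
open Literature.Geometry.ComplexHyperbolic.BallModel
open scoped MatrixGroups Matrix.Norms.Operator ContDiff ENNReal

namespace Literature.NumberTheory.Rogawski1990

section MixedTower

variable {J : Matrix (Fin 2) (Fin 2) ℂ} (hJ : J = (StdForm.antidiagonal 2).over ℂ)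
  [MeasurableSpace ↥(unitaryGroupOfForm (starRingEnd ℂ) J)] [BorelSpace ↥(unitaryGroupOfForm (starRingEnd ℂ) J)]
  (μ₀ : Measure ↥(unitaryGroupOfForm (starRingEnd ℂ) J))
  (L : Type) [Field L] (α : Fin 3 → L)
  [∀ w : {w : InfinitePlace L // IsComplex w}, MeasurableSpace (archLocal L 3 (Matrix.diagonal α) w)] [∀ w : {w : InfinitePlace L // IsComplex w}, BorelSpace (archLocal L 3 (Matrix.diagonal α) w)]
  (ν : ∀ w : {w : InfinitePlace L // IsComplex w}, Measure (archLocal L 3 (Matrix.diagonal α) w)) (ζ : {w : InfinitePlace L // IsComplex w} → Circle)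
  {E : Type} [NormedAddCommGroup E] [NormedSpace ℝ E] [CompleteSpace E]

include hJ in
/-- **MIXED TOWER BOUNDS** (see the module docstring).  Stage 1 = the face tower ★ p851247 with the `U(J)`-Cayley reader (sockets ★ `cayley_nestedReader_hunif ∕ _hread`), stage 2 = the central tower
★ p851321 with the place-indexed central readers (sockets ★ p851275), glued by ★ (E5). [cite: WarnerHASSLG2, Thm. 8.4.3.1] [cite: Varadarajan1977, Part I §1.12]
[cite: Bouaziz1994IntegralesOrbitales, §3.1 (I₁)–(I₂) p. 579] [cite: HormanderALPDO1, §1.1 Thm. 1.1.8–1.1.9] -/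
theorem contDiffOn_and_forall_bound_mixedTower [μ₀.IsHaarMeasure] [μ₀.IsMulRightInvariant]
    (hα : ∀ i, α i ≠ 0) (hreal : ∀ (w : {w : InfinitePlace L // IsComplex w}) (i : Fin 3), (w.1.embedding (α i)).im = 0)
    [∀ w : {w : InfinitePlace L // IsComplex w}, (ν w).IsHaarMeasure] [∀ w : {w : InfinitePlace L // IsComplex w}, (ν w).IsMulRightInvariant] (e₂ : ℕ → {w : InfinitePlace L // IsComplex w})
    (m₁ m₂ : ℕ) (P : Type) [NormedAddCommGroup P] [NormedSpace ℝ P] [FiniteDimensional ℝ P] {Q : Set P} (hQ : IsOpen Q)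
    (f : P × ((Fin m₁ → Matrix (Fin 2) (Fin 2) ℂ) × (Fin m₂ → Matrix (Fin 3) (Fin 3) ℂ)) → E) (hf : ContDiffOn ℝ ∞ f (Q ×ˢ univ))
    {C₁ : Set (Matrix (Fin 2) (Fin 2) ℂ)} (hC₁ : IsCompact C₁) (hfC₁ : ∀ (q : P) (X : (Fin m₁ → Matrix (Fin 2) (Fin 2) ℂ) × (Fin m₂ → Matrix (Fin 3) (Fin 3) ℂ)), (∃ k, X.1 k ∉ C₁) → f (q, X) = 0)
    {C₂ : Set (Matrix (Fin 3) (Fin 3) ℂ)} (hC₂ : IsCompact C₂) (hfC₂ : ∀ (q : P) (X : (Fin m₁ → Matrix (Fin 2) (Fin 2) ℂ) × (Fin m₂ → Matrix (Fin 3) (Fin 3) ℂ)), (∃ k, X.2 k ∉ C₂) → f (q, X) = 0)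
    (S : Set P) (hfbd : ∀ n : ℕ, ∃ B : ℝ, ∀ z ∈ (S ∩ Q) ×ˢ (univ : Set ((Fin m₁ → Matrix (Fin 2) (Fin 2) ℂ) × (Fin m₂ → Matrix (Fin 3) (Fin 3) ℂ))), ‖iteratedFDeriv ℝ n f z‖ ≤ B) :
    ContDiffOn ℝ ∞ (fun z : (P × (Fin m₁ → ℝ)) × (Fin m₂ → Fin 3 → ℝ) =>
        ((∏ k : Fin m₂, rootProduct (z.2 k)) • ∫ g : ((k : Fin m₂) → archLocal L 3 (Matrix.diagonal α) (e₂ k.val)),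
          (fun z' : (P × (Fin m₁ → ℝ)) × (Fin m₂ → Matrix (Fin 3) (Fin 3) ℂ) =>
        ((∏ k : Fin m₁, 2 * Real.sin (z'.1.2 k)) • ∫ h : Fin m₁ → ↥(unitaryGroupOfForm (starRingEnd ℂ) J),
          (fun y : (P × (Fin m₂ → Matrix (Fin 3) (Fin 3) ℂ)) × (Fin m₁ → Matrix (Fin 2) (Fin 2) ℂ) => f (y.1.1, (y.2, y.1.2))) ((z'.1.1, z'.2), fun k => (((h k * ⟨Matrix.GeneralLinearGroup.mkOfDetNeZero !![(1 : ℂ), 1; 1, -1] det_cayleyTwo_ne_zero * circleDiagonal 2 ![Circle.exp (z'.1.2 k), Circle.exp (-(z'.1.2 k))] * (Matrix.GeneralLinearGroup.mkOfDetNeZero !![(1 : ℂ), 1; 1, -1] det_cayleyTwo_ne_zero)⁻¹, cayley_conj_circleDiagonal_mem_of_eq_over hJ _⟩ * (h k)⁻¹ : ↥(unitaryGroupOfForm (starRingEnd ℂ) J)) : GL (Fin 2) ℂ) : Matrix (Fin 2) (Fin 2) ℂ)) ∂(Measure.pi fun _ : Fin m₁ => μ₀))) (z.1, fun k => (((g k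 * (⟨circleDiagonal 3 (fun i => ζ (e₂ k.val) * Circle.exp ((z.2 k) i)), circleDiagonal_mem_archLocal_diagonal L 3 α (e₂ k.val) _⟩ : archLocal L 3 (Matrix.diagonal α) (e₂ k.val)) * (g k)⁻¹ : archLocal L 3 (Matrix.diagonal α) (e₂ k.val)) : GL (Fin 3) ℂ) : Matrix (Fin 3) (Fin 3) ℂ)) ∂(Measure.pi fun k : Fin m₂ => ν (e₂ k.val))))
        ((Q ×ˢ Set.pi univ fun _ => {ψ : ℝ | Real.sin ψ ≠ 0}) ×ˢ Set.pi univ fun _ => ({θ : Fin 3 → ℝ | ∃ σ : Equiv.Perm (Fin 3), θ (σ 0) < θ (σ 1) ∧ θ (σ 1) < θ (σ 2)} ∩ ball (0 : Fin 3 → ℝ) (1 / 2))) ∧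
      ∀ n : ℕ, ∃ B : ℝ, ∀ z ∈ ((S ∩ Q) ×ˢ Set.pi univ (fun _ => {ψ : ℝ | Real.sin ψ ≠ 0} ∩ Icc (-(1 / 2 : ℝ)) (1 / 2))) ×ˢ Set.pi univ (fun _ => ({θ : Fin 3 → ℝ | ∃ σ : Equiv.Perm (Fin 3), θ (σ 0) < θ (σ 1) ∧ θ (σ 1) < θ (σ 2)} ∩ ball (0 : Fin 3 → ℝ) (1 / 2)) ∩ ball (0 : Fin 3 → ℝ) (1 / 4)),
        ‖iteratedFDeriv ℝ n (fun z : (P × (Fin m₁ → ℝ)) × (Fin m₂ → Fin 3 → ℝ) =>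
        ((∏ k : Fin m₂, rootProduct (z.2 k)) • ∫ g : ((k : Fin m₂) → archLocal L 3 (Matrix.diagonal α) (e₂ k.val)),
          (fun z' : (P × (Fin m₁ → ℝ)) × (Fin m₂ → Matrix (Fin 3) (Fin 3) ℂ) =>
        ((∏ k : Fin m₁, 2 * Real.sin (z'.1.2 k)) • ∫ h : Fin m₁ → ↥(unitaryGroupOfForm (starRingEnd ℂ) J),
          (fun y : (P × (Fin m₂ → Matrix (Fin 3) (Fin 3) ℂ)) × (Fin m₁ → Matrix (Fin 2) (Fin 2) ℂ) => f (y.1.1, (y.2, y.1.2))) ((z'.1.1, z'.2), fun k => (((h k * ⟨Matrix.GeneralLinearGroup.mkOfDetNeZero !![(1 : ℂ), 1; 1, -1] det_cayleyTwo_ne_zero * circleDiagonal 2 ![Circle.exp (z'.1.2 k), Circle.exp (-(z'.1.2 k))] * (Matrix.GeneralLinearGroup.mkOfDetNeZero !![(1 : ℂ), 1; 1, -1] det_cayleyTwo_ne_zero)⁻¹, cayley_conj_circleDiagonal_mem_of_eq_over hJ _⟩ * (h k)⁻¹ : ↥(unitaryGroupOfForm (starRingEnd ℂ) J)) : GL (Fin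 2) ℂ) : Matrix (Fin 2) (Fin 2) ℂ)) ∂(Measure.pi fun _ : Fin m₁ => μ₀))) (z.1, fun k => (((g k * (⟨circleDiagonal 3 (fun i => ζ (e₂ k.val) * Circle.exp ((z.2 k) i)), circleDiagonal_mem_archLocal_diagonal L 3 α (e₂ k.val) _⟩ : archLocal L 3 (Matrix.diagonal α) (e₂ k.val)) * (g k)⁻¹ : archLocal L 3 (Matrix.diagonal α) (e₂ k.val)) : GL (Fin 3) ℂ) : Matrix (Fin 3) (Fin 3) ℂ)) ∂(Measure.pi fun k : Fin m₂ => ν (e₂ k.val)))) z‖ ≤ B := by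
  haveI : LocallyCompactSpace ↥(unitaryGroupOfForm (starRingEnd ℂ) J) := locallyCompactSpace_unitaryGroupOfForm_complex J
  haveI : SecondCountableTopology ↥(unitaryGroupOfForm (starRingEnd ℂ) J) := secondCountableTopology_unitaryGroupOfForm_complex J
  -- STAGE 1 sockets: the centre-`1` `U(J)`-Cayley reader
  obtain ⟨Φ₁, hΦ₁⟩ : ∃ Φ₁ : Unit → (Matrix (Fin 2) (Fin 2) ℂ → E) → ℝ → E, ∀ (u : Unit) (g : Matrix (Fin 2) (Fin 2) ℂ → E) (ψ : ℝ), Φ₁ u g ψ = ((2 * Real.sin ψ) • ∫ h : ↥(unitaryGroupOfForm (starRingEnd ℂ) J), g (((h * ⟨Matrix.GeneralLinearGroup.mkOfDetNeZero !![(1 : ℂ), 1; 1, -1] det_cayleyTwo_ne_zero * circleDiagonal 2 ![Circle.exp ψ, Circle.exp (-ψ)] * (Matrix.GeneralLinearGroup.mkOfDetNeZero !![(1 : ℂ), 1; 1, -1] det_cayleyTwo_ne_zero)⁻¹, cayley_conj_circleDiagonal_mem_of_eq_over hJ _⟩ * (h)⁻¹ : ↥(unitaryGroupOfForm (starRingEnd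 ℂ) J)) : GL (Fin 2) ℂ) : Matrix (Fin 2) (Fin 2) ℂ) ∂μ₀) :=
    ⟨fun _ g ψ => ((2 * Real.sin ψ) • ∫ h : ↥(unitaryGroupOfForm (starRingEnd ℂ) J), g (((h * ⟨Matrix.GeneralLinearGroup.mkOfDetNeZero !![(1 : ℂ), 1; 1, -1] det_cayleyTwo_ne_zero * circleDiagonal 2 ![Circle.exp ψ, Circle.exp (-ψ)] * (Matrix.GeneralLinearGroup.mkOfDetNeZero !![(1 : ℂ), 1; 1, -1] det_cayleyTwo_ne_zero)⁻¹, cayley_conj_circleDiagonal_mem_of_eq_over hJ _⟩ * (h)⁻¹ : ↥(unitaryGroupOfForm (starRingEnd ℂ) J)) : GL (Fin 2) ℂ) : Matrix (Fin 2) (Fin 2) ℂ) ∂μ₀), fun _ _ _ => rfl⟩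
  have hΦ₁' : ∀ (u : Unit) (g : Matrix (Fin 2) (Fin 2) ℂ → E) (ψ : ℝ), Φ₁ u g ψ = (2 * Real.sin ψ) • ∫ h : ↥(unitaryGroupOfForm (starRingEnd ℂ) J),
      g (((h * ⟨Matrix.GeneralLinearGroup.mkOfDetNeZero !![(1 : ℂ), 1; 1, -1] det_cayleyTwo_ne_zero * circleDiagonal 2 ![1 * Circle.exp ψ, 1 * Circle.exp (-ψ)] * (Matrix.GeneralLinearGroup.mkOfDetNeZero !![(1 : ℂ), 1; 1, -1] det_cayleyTwo_ne_zero)⁻¹, cayley_conj_circleDiagonal_mem_of_eq_over hJ _⟩ * (h)⁻¹ : ↥(unitaryGroupOfForm (starRingEnd ℂ) J)) : GL (Fin 2) ℂ) : Matrix (Fin 2) (Fin 2) ℂ) ∂μ₀ := by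
    intro u g ψ; rw [hΦ₁]; simp only [one_mul]
  have hT₁ : IsOpen {ψ : ℝ | Real.sin ψ ≠ 0} := isOpen_ne_fun Real.continuous_sin continuous_const
  have hunif₁ : ∀ (u : Unit) (J' : Type) (Gf : Matrix (Fin 2) (Fin 2) ℂ → lp (fun _ : J' => E) ⊤), ContDiff ℝ ∞ Gf → HasCompactSupport Gf → ∀ n : ℕ,
      ∃ B : ℝ, ∀ ψ ∈ {ψ : ℝ | Real.sin ψ ≠ 0} ∩ Icc (-(1 / 2 : ℝ)) (1 / 2), ∀ ℓ : lp (fun _ : J' => E) ⊤ →L[ℝ] E, ‖iteratedFDeriv ℝ n (Φ₁ u (fun X => ℓ (Gf X))) ψ‖ ≤ ‖ℓ‖ * B := by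
    intro u J' Gf hGf hGfc n
    obtain ⟨B, hB⟩ := cayley_nestedReader_hunif hJ μ₀ 1 (Φ₁ u) (hΦ₁' u) (T₀ := Icc (-(1 / 2 : ℝ)) (1 / 2)) le_rfl J' Gf hGf hGfc n
    exact ⟨B, fun ψ hψ ℓ => by rw [norm_iteratedFDeriv_eq_norm_iteratedDeriv]; exact hB ψ hψ ℓ⟩
  have hread₁ : ∀ (u : Unit) (P' : Type) [NormedAddCommGroup P'] [NormedSpace ℝ P'] [FiniteDimensional ℝ P'] (O : Set P'), IsOpen O → ∀ g : P' → Matrix (Fin 2) (Fin 2) ℂ → E,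
      ContDiffOn ℝ ∞ (uncurry g) (O ×ˢ univ) → (∃ C : Set (Matrix (Fin 2) (Fin 2) ℂ), IsCompact C ∧ ∀ q ∈ O, ∀ X, X ∉ C → g q X = 0) →
        ContDiffOn ℝ ∞ (fun z : P' × ℝ => Φ₁ u (g z.1) z.2) (O ×ˢ {ψ : ℝ | Real.sin ψ ≠ 0}) ∧
        ∀ (v : P') (z : P' × ℝ), z ∈ O ×ˢ {ψ : ℝ | Real.sin ψ ≠ 0} → fderiv ℝ (fun z : P' × ℝ => Φ₁ u (g z.1) z.2) z (v, 0) = Φ₁ u (fun X => fderiv ℝ (fun q' => g q' X) z.1 v) z.2 :=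
    fun u => cayley_nestedReader_hread hJ μ₀ 1 (Φ₁ u) (hΦ₁' u)
  -- STAGE 1 tower (closed form ★ p851247) and its laws
  obtain ⟨H₁, hH₁⟩ : ∃ H₁ : (ℕ → Unit) → ∀ (m : ℕ) (P' : Type), (P' × (Fin m → Matrix (Fin 2) (Fin 2) ℂ) → E) → (P' × (Fin m → ℝ) → E),
      ∀ (e : ℕ → Unit) (m : ℕ) (P' : Type) (f' : P' × (Fin m → Matrix (Fin 2) (Fin 2) ℂ) → E), H₁ e m P' f' = fun z : P' × (Fin m → ℝ) =>
        ((∏ k : Fin m, 2 * Real.sin (z.2 k)) • ∫ h : Fin m → ↥(unitaryGroupOfForm (starRingEnd ℂ) J),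
          f' (z.1, fun k => (((h k * ⟨Matrix.GeneralLinearGroup.mkOfDetNeZero !![(1 : ℂ), 1; 1, -1] det_cayleyTwo_ne_zero * circleDiagonal 2 ![Circle.exp (z.2 k), Circle.exp (-(z.2 k))] * (Matrix.GeneralLinearGroup.mkOfDetNeZero !![(1 : ℂ), 1; 1, -1] det_cayleyTwo_ne_zero)⁻¹, cayley_conj_circleDiagonal_mem_of_eq_over hJ _⟩ * (h k)⁻¹ : ↥(unitaryGroupOfForm (starRingEnd ℂ) J)) : GL (Fin 2) ℂ) : Matrix (Fin 2) (Fin 2) ℂ)) ∂(Measure.pi fun _ : Fin m => μ₀)) :=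
    ⟨fun _ m P' f' z => ((∏ k : Fin m, 2 * Real.sin (z.2 k)) • ∫ h : Fin m → ↥(unitaryGroupOfForm (starRingEnd ℂ) J),
          f' (z.1, fun k => (((h k * ⟨Matrix.GeneralLinearGroup.mkOfDetNeZero !![(1 : ℂ), 1; 1, -1] det_cayleyTwo_ne_zero * circleDiagonal 2 ![Circle.exp (z.2 k), Circle.exp (-(z.2 k))] * (Matrix.GeneralLinearGroup.mkOfDetNeZero !![(1 : ℂ), 1; 1, -1] det_cayleyTwo_ne_zero)⁻¹, cayley_conj_circleDiagonal_mem_of_eq_over hJ _⟩ * (h k)⁻¹ : ↥(unitaryGroupOfForm (starRingEnd ℂ) J)) : GL (Fin 2) ℂ) : Matrix (Fin 2) (Fin 2) ℂ)) ∂(Measure.pi fun _ : Fin m => μ₀)), fun _ _ _ _ => rfl⟩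
  have hH0₁ : ∀ (e : ℕ → Unit) (P' : Type) (f' : P' × (Fin 0 → Matrix (Fin 2) (Fin 2) ℂ) → E) (q : P') (θ : Fin 0 → ℝ), H₁ e 0 P' f' (q, θ) = f' (q, fun k => k.elim0) :=
    fun e P' f' q θ => by rw [hH₁]; exact towerH_zero hJ μ₀ P' f' q θ
  have hHzero₁ : ∀ (e : ℕ → Unit) (m : ℕ) (P' : Type) (f' : P' × (Fin m → Matrix (Fin 2) (Fin 2) ℂ) → E) (q : P') (θ : Fin m → ℝ),
      (∀ X, f' (q, X) = 0) → H₁ e m P' f' (q, θ) = 0 :=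
    fun e m P' f' q θ h0 => by rw [hH₁]; exact towerH_eq_zero hJ μ₀ m P' f' q θ h0
  have hHsucc₁ : ∀ (e : ℕ → Unit) (m : ℕ) (P' : Type) [NormedAddCommGroup P'] [NormedSpace ℝ P'] (Q' : Set P'), IsOpen Q' →
      ∀ (f' : P' × (Fin (m + 1) → Matrix (Fin 2) (Fin 2) ℂ) → E),
      ContDiffOn ℝ ∞ f' (Q' ×ˢ univ) → (∃ C : Set (Matrix (Fin 2) (Fin 2) ℂ), IsCompact C ∧ ∀ (q : P') (X : Fin (m + 1) → Matrix (Fin 2) (Fin 2) ℂ), (∃ k, X k ∉ C) → f' (q, X) = 0) →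
      ∀ q ∈ Q', ∀ θ : Fin (m + 1) → ℝ, (∀ k, θ k ∈ {ψ : ℝ | Real.sin ψ ≠ 0}) →
        H₁ e (m + 1) P' f' (q, θ) = Φ₁ (e 0) (fun X₀ => H₁ (fun k => e (k + 1)) m (P' × Matrix (Fin 2) (Fin 2) ℂ) (fun p => f' (p.1.1, Fin.cons p.1.2 p.2)) ((q, X₀), Fin.tail θ)) (θ 0) := by
    intro e m P' _ _ Q' hQ' f' hf' hC' q hq θ hθ
    have key := towerH_succ hJ μ₀ (Φ₁ (e 0)) (hΦ₁ (e 0)) m P' Q' hQ' f' hf' hC' q hq θ hθ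
    simpa only [hH₁] using key
  -- STAGE 2 sockets: the central readers, indexed by the place
  obtain ⟨Φ₂, hΦ₂⟩ : ∃ Φ₂ : {w : InfinitePlace L // IsComplex w} → (Matrix (Fin 3) (Fin 3) ℂ → E) → (Fin 3 → ℝ) → E, ∀ (w : {w : InfinitePlace L // IsComplex w}) (F : Matrix (Fin 3) (Fin 3) ℂ → E) (θ : Fin 3 → ℝ), Φ₂ w F θ = ((rootProduct θ : ℝ) • ∫ g : archLocal L 3 (Matrix.diagonal α) w, F (((g * (⟨circleDiagonal 3 (fun i => ζ w * Circle.exp (θ i)), circleDiagonal_mem_archLocal_diagonal L 3 α w _⟩ : archLocal L 3 (Matrix.diagonal α) w) * (g)⁻¹ : archLocal L 3 (Matrix.diagonal α) w) : GL (Fin 3) ℂ) : Matrix (Fin 3) (Fin 3) ℂ) ∂(ν w)) :=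
    ⟨fun w F θ => ((rootProduct θ : ℝ) • ∫ g : archLocal L 3 (Matrix.diagonal α) w, F (((g * (⟨circleDiagonal 3 (fun i => ζ w * Circle.exp (θ i)), circleDiagonal_mem_archLocal_diagonal L 3 α w _⟩ : archLocal L 3 (Matrix.diagonal α) w) * (g)⁻¹ : archLocal L 3 (Matrix.diagonal α) w) : GL (Fin 3) ℂ) : Matrix (Fin 3) (Fin 3) ℂ) ∂(ν w)), fun _ _ _ => rfl⟩
  have hopen : IsOpen {θ : Fin 3 → ℝ | ∃ σ : Equiv.Perm (Fin 3), θ (σ 0) < θ (σ 1) ∧ θ (σ 1) < θ (σ 2)} := by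
    rw [Set.setOf_exists]; exact isOpen_iUnion fun σ => isOpen_chamber σ
  have hT₂ : IsOpen ({θ : Fin 3 → ℝ | ∃ σ : Equiv.Perm (Fin 3), θ (σ 0) < θ (σ 1) ∧ θ (σ 1) < θ (σ 2)} ∩ ball (0 : Fin 3 → ℝ) (1 / 2)) := hopen.inter isOpen_ball
  have hunif₂ : ∀ (w : {w : InfinitePlace L // IsComplex w}) (J' : Type) (Gf : Matrix (Fin 3) (Fin 3) ℂ → lp (fun _ : J' => E) ⊤), ContDiff ℝ ∞ Gf → HasCompactSupport Gf → ∀ n : ℕ,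
      ∃ B : ℝ, ∀ θ ∈ ({θ : Fin 3 → ℝ | ∃ σ : Equiv.Perm (Fin 3), θ (σ 0) < θ (σ 1) ∧ θ (σ 1) < θ (σ 2)} ∩ ball (0 : Fin 3 → ℝ) (1 / 2)) ∩ ball (0 : Fin 3 → ℝ) (1 / 4), ∀ ℓ : lp (fun _ : J' => E) ⊤ →L[ℝ] E, ‖iteratedFDeriv ℝ n (Φ₂ w (fun X => ℓ (Gf X))) θ‖ ≤ ‖ℓ‖ * B := by
    intro w J' Gf hGf hGfc n
    obtain ⟨B, hB⟩ := exists_forall_norm_iteratedFDeriv_centralReader_comp_clm_le (E := E) (E' := lp (fun _ : J' => E) ⊤) L α w hα (hreal w) (ν w) (ζ w) Gf hGf hGfc n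
    refine ⟨B, fun θ hθ ℓ => ?_⟩
    rw [show Φ₂ w (fun X => ℓ (Gf X)) = _ from funext fun θ => hΦ₂ w (fun X => ℓ (Gf X)) θ]
    exact hB θ hθ ℓ
  have hread₂ : ∀ (w : {w : InfinitePlace L // IsComplex w}) (P' : Type) [NormedAddCommGroup P'] [NormedSpace ℝ P'] [FiniteDimensional ℝ P'] (O : Set P'), IsOpen O → ∀ gf : P' → Matrix (Fin 3) (Fin 3) ℂ → E,
      ContDiffOn ℝ ∞ (uncurry gf) (O ×ˢ univ) → (∃ C : Set (Matrix (Fin 3) (Fin 3) ℂ), IsCompact C ∧ ∀ q ∈ O, ∀ X, X ∉ C → gf q X = 0) →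
        ContDiffOn ℝ ∞ (fun z : P' × (Fin 3 → ℝ) => Φ₂ w (gf z.1) z.2) (O ×ˢ ({θ : Fin 3 → ℝ | ∃ σ : Equiv.Perm (Fin 3), θ (σ 0) < θ (σ 1) ∧ θ (σ 1) < θ (σ 2)} ∩ ball (0 : Fin 3 → ℝ) (1 / 2))) ∧
        ∀ (v : P') (z : P' × (Fin 3 → ℝ)), z ∈ O ×ˢ ({θ : Fin 3 → ℝ | ∃ σ : Equiv.Perm (Fin 3), θ (σ 0) < θ (σ 1) ∧ θ (σ 1) < θ (σ 2)} ∩ ball (0 : Fin 3 → ℝ) (1 / 2)) → fderiv ℝ (fun z : P' × (Fin 3 → ℝ) => Φ₂ w (gf z.1) z.2) z (v, 0) = Φ₂ w (fun X => fderiv ℝ (fun q' => gf q' X) z.1 v) z.2 := by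
    intro w P' _ _ _ O hO gf hg hgc
    have hfun : (fun z : P' × (Fin 3 → ℝ) => Φ₂ w (gf z.1) z.2) = fun z : P' × (Fin 3 → ℝ) => ((rootProduct z.2 : ℝ) • ∫ g : archLocal L 3 (Matrix.diagonal α) w, (gf z.1) (((g * (⟨circleDiagonal 3 (fun i => ζ w * Circle.exp (z.2 i)), circleDiagonal_mem_archLocal_diagonal L 3 α w _⟩ : archLocal L 3 (Matrix.diagonal α) w) * (g)⁻¹ : archLocal L 3 (Matrix.diagonal α) w) : GL (Fin 3) ℂ) : Matrix (Fin 3) (Fin 3) ℂ) ∂(ν w)) := funext fun z => hΦ₂ w _ _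
    refine ⟨?_, fun v z hz => ?_⟩
    · rw [hfun]; exact contDiffOn_centralReader_param_of_isOpen L α w hα (hreal w) (ν w) (ζ w) hO gf hg hgc
    · rw [hfun, hΦ₂]; exact fderiv_centralReader_param_prod_apply_of_isOpen L α w hα (hreal w) (ν w) (ζ w) hO gf hg hgc v hz
  -- STAGE 2 tower (closed form ★ p851321) and its laws
  obtain ⟨H₂, hH₂⟩ : ∃ H₂ : (ℕ → {w : InfinitePlace L // IsComplex w}) → ∀ (m : ℕ) (P' : Type), (P' × (Fin m → Matrix (Fin 3) (Fin 3) ℂ) → E) → (P' × (Fin m → Fin 3 → ℝ) → E),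
      ∀ (e : ℕ → {w : InfinitePlace L // IsComplex w}) (m : ℕ) (P' : Type) (f' : P' × (Fin m → Matrix (Fin 3) (Fin 3) ℂ) → E), H₂ e m P' f' = fun z : P' × (Fin m → Fin 3 → ℝ) =>
        ((∏ k : Fin m, rootProduct (z.2 k)) • ∫ g : ((k : Fin m) → archLocal L 3 (Matrix.diagonal α) (e k.val)),
          f' (z.1, fun k => (((g k * (⟨circleDiagonal 3 (fun i => ζ (e k.val) * Circle.exp ((z.2 k) i)), circleDiagonal_mem_archLocal_diagonal L 3 α (e k.val) _⟩ : archLocal L 3 (Matrix.diagonal α) (e k.val)) * (g k)⁻¹ : archLocal L 3 (Matrix.diagonal α) (e k.val)) : GL (Fin 3) ℂ) : Matrix (Fin 3) (Fin 3) ℂ)) ∂(Measure.pi fun k : Fin m => ν (e k.val))) :=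
    ⟨fun e m P' f' z => ((∏ k : Fin m, rootProduct (z.2 k)) • ∫ g : ((k : Fin m) → archLocal L 3 (Matrix.diagonal α) (e k.val)),
          f' (z.1, fun k => (((g k * (⟨circleDiagonal 3 (fun i => ζ (e k.val) * Circle.exp ((z.2 k) i)), circleDiagonal_mem_archLocal_diagonal L 3 α (e k.val) _⟩ : archLocal L 3 (Matrix.diagonal α) (e k.val)) * (g k)⁻¹ : archLocal L 3 (Matrix.diagonal α) (e k.val)) : GL (Fin 3) ℂ) : Matrix (Fin 3) (Fin 3) ℂ)) ∂(Measure.pi fun k : Fin m => ν (e k.val))), fun _ _ _ _ => rfl⟩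
  have hH0₂ : ∀ (e : ℕ → {w : InfinitePlace L // IsComplex w}) (P' : Type) (f' : P' × (Fin 0 → Matrix (Fin 3) (Fin 3) ℂ) → E) (q : P') (θ : Fin 0 → Fin 3 → ℝ), H₂ e 0 P' f' (q, θ) = f' (q, fun k => k.elim0) :=
    fun e P' f' q θ => by rw [hH₂]; exact centralTower_zero L α ν ζ e P' f' q θ
  have hHzero₂ : ∀ (e : ℕ → {w : InfinitePlace L // IsComplex w}) (m : ℕ) (P' : Type) (f' : P' × (Fin m → Matrix (Fin 3) (Fin 3) ℂ) → E) (q : P') (θ : Fin m → Fin 3 → ℝ),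
      (∀ X, f' (q, X) = 0) → H₂ e m P' f' (q, θ) = 0 :=
    fun e m P' f' q θ h0 => by rw [hH₂]; exact centralTower_eq_zero L α ν ζ e m P' f' q θ h0
  have hHsucc₂ : ∀ (e : ℕ → {w : InfinitePlace L // IsComplex w}) (m : ℕ) (P' : Type) [NormedAddCommGroup P'] [NormedSpace ℝ P'] (Q' : Set P'), IsOpen Q' →
      ∀ (f' : P' × (Fin (m + 1) → Matrix (Fin 3) (Fin 3) ℂ) → E),
      ContDiffOn ℝ ∞ f' (Q' ×ˢ univ) → (∃ C : Set (Matrix (Fin 3) (Fin 3) ℂ), IsCompact C ∧ ∀ (q : P') (X : Fin (m + 1) → Matrix (Fin 3) (Fin 3) ℂ), (∃ k, X k ∉ C) → f' (q, X) = 0) →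
      ∀ q ∈ Q', ∀ θ : Fin (m + 1) → Fin 3 → ℝ, (∀ k, θ k ∈ ({θ : Fin 3 → ℝ | ∃ σ : Equiv.Perm (Fin 3), θ (σ 0) < θ (σ 1) ∧ θ (σ 1) < θ (σ 2)} ∩ ball (0 : Fin 3 → ℝ) (1 / 2))) →
        H₂ e (m + 1) P' f' (q, θ) = Φ₂ (e 0) (fun X₀ => H₂ (fun k => e (k + 1)) m (P' × Matrix (Fin 3) (Fin 3) ℂ) (fun p => f' (p.1.1, Fin.cons p.1.2 p.2)) ((q, X₀), Fin.tail θ)) (θ 0) := by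
    intro e m P' _ _ Q' hQ' f' hf' hC' q hq θ hθ
    have key := centralTower_succ L α ν ζ hα hreal e m P' Q' hQ' f' hf' hC' q hq θ hθ
    simpa only [hH₂, hΦ₂] using key
  -- ★ (E5)
  have main := contDiffOn_and_forall_bound_twoStage_nestedBlockReaders (E := E) Φ₁ hT₁ (Icc (-(1 / 2 : ℝ)) (1 / 2)) hunif₁ hread₁ H₁ hH0₁ hHsucc₁ hHzero₁ (fun _ => ())
    Φ₂ hT₂ (ball (0 : Fin 3 → ℝ) (1 / 4)) hunif₂ hread₂ H₂ hH0₂ hHsucc₂ hHzero₂ e₂ m₁ m₂ P hQ f hf hC₁ hfC₁ hC₂ hfC₂ S hfbd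
  simpa only [hH₂, hH₁] using main

end MixedTower

end Literature.NumberTheory.Rogawski1990

end
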